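import Summits.QuantumFields.YangMills.Theorems.BalabanUVNodesN09SelectorContinuousOfThm1TwoRadii
import Summits.QuantumFields.YangMills.Theorems.BalabanUVNodesN07DirectMethodInduction
import Summits.QuantumFields.YangMills.Theorems.BalabanUVNodesN09FlatSectorUniqueness

/-!
# NODE N09 [B12] — THE BACKGROUND ACTION OF RECORD `V ↦ A^η(U_k(V))` ((0.22)'s main term) IS CONTINUOUS ON THE SMALL-FIELD DOMAIN FOR THE BARE
# CHOICE `Uk` (no uniqueness needed: the VALUE is canonical); A6: the continuity hypotheses are inhabited on the flat sector at every level

Cell `pub-ymgap` (YM-PLAN Track A), seat `pub-ymgap-dag-n09-w1` g6 (D-0149 width seat 1 of node N09 [B12] = [Balaban1987RG1]); count-neutral helper of the K1-face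
(`--supports stmt-QuantumFields-27364 --as helper`).  [I] = [Balaban1987RG1] (CMP 109), [B11] = [Balaban1985Variational] (CMP 102), [B7] = [Balaban1985Averaging].

WHY.  This seat's Berge line (`Literature/Topology/MaximumTheoremMovingConstraint.lean` + `…N09SelectorContinuousOfUniqueOrbit` + `…N09AveragingOpenAtSmallFields` +
`…N09SelectorContinuousOfThm1TwoRadii`) makes the SELECTED minimiser `UkSel` and the critical configuration `critCfgSelOfRecord` continuous from [B11] Thm 1's two-radii
binders; the record's own bare choice `Node00.Uk` (`Classical.choose` on the minimal orbit) has NO continuous dependence to speak of.  But the VALUE of (0.21) — node00-def-B's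
background action of record `wilsonBGOfRecord ε p k V = A^η(U_k(V))`, the main term `−g_k⁻² A^η(U_k(V))` of the representation (0.22) of the effective action — IS canonical
(`Node00.wilsonAction4_eq_of_isBackground`: every minimiser has the chosen one's action), and Berge's theorem has a VALUE half (Beavis–Dobbs Thm 3.6 «g is continuous at x»,
`Literature.Topology.tendsto_optimalValue`) that needs NO uniqueness.  THIS FILE proves: the background action of record, READ THROUGH THE BARE `Uk`, is continuous on every
set of small coarse data carrying (E) open-class solvability and (I) N07's interiority — hence on the small-field domains from the two-radii binders `h11 ∧ hreg8` — plus
(53)-type numerics ((O) being this seat's theorem).  §3 is the A6 companion of the whole line: at every flat-sector datum `V = M^k(U_f)` (every level `k ≤ m + K`, every radius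
`e > 0`) the displayed inputs (E), (I), (U) and the two-radii binders HOLD (dag-n09-w1 g3's flat-sector rigidity + `A ≥ 0`).

WHAT IS PROVED (theorems only, 0 `def`, 0 `sorry`).
§1 ★ `isBackground_closure_Uk_of_interior` (under (E)+(I) the bare `U_k(V)` minimises over the CLOSED class too) · ★★★ `continuousWithinAt_wilsonAction4_Uk_of_interior` ·
   `continuousOn_wilsonAction4_Uk_of_interior` — `V ↦ A(U_k^{(e)}(V))` continuous on `D` from (E), (I), `e < α₀` + numerics (`k ≤ m + K`); NO uniqueness hypothesis.
§2 ★★★ `continuousOn_wilsonAction4_Uk_domAlt_of_thm1_εbg_of_reg8` — on every small-field domain `domAltOfRecord ν K k`, `k ≤ K`, from dag-n09-w1 g2's two-radii binders `h11`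
   (at `εbg`) and `hreg8`, `ν.εreg < εbg`, numerics; ★★ `continuousOn_wilsonBGOfRecord_domAlt_of_thm1_εbg_of_reg8` — the same for node00-def-B's `wilsonBGOfRecord ν.εreg p k` at the runs.
§3 A6: `flatSector_inputs` — at `V = M^k(U_f)`, `U_f` plaquette-flat, `0 < e`, `k ≤ m + K`: (E) ∧ (I) ∧ (U) at radius `e`; `flatSector_twoRadii_inputs` — `h11` at any `εbg > 0` and
   `hreg8` at any `e > 0` (dag-n09-w1 g3 `h11_of_flat_iter` ∕ `Uk_mem_bgReg_of_flat_iter`); so none of the line's displayed binders is vacuous at any level.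

HONEST FRAMING.  Count-neutral kernel topology ∕ bookkeeping BY NAME; [B11] Thm 1 (two-radii binders) and N07's interiority stay DISPLAYED off the flat sector; numerics displayed;
NO carrier re-pointed; `hreg` ∕ N09 NOT discharged; conjunct 1 (Lemma 4) ∕ FLAG №7 untouched; K0⁷ ∕ K1⁹ ∕ K3⁸ NOT closed; counts unmoved (typed 28∕28 · discharged 5∕28); one finite
four-torus programme at fixed `ε = L^{−K}` per run — R4 closes the conditional rung `BalabanLadder.UV` only; NOT ℝ⁴ ∕ infinite volume ∕ OS; the Yang–Mills mass gap (Clay) is NOT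
proved by any of this.
-/

noncomputable section

open scoped Topology
open Set Filter

namespace Summit.QuantumFields.YangMills.BalabanUVNodes.N09BackgroundActionContinuous

open Literature.Topology (tendsto_optimalValue)
open Literature.MathematicalPhysics.QuantumFieldTheory.Balaban1983to89
open Literature.MathematicalPhysics.QuantumFieldTheory.Balaban1983to89.T4Continuum (T4Family)
open Literature.MathematicalPhysics.QuantumFieldTheory.Balaban1983to89.ExpMeanLog (deltaSU)
open Literature.MathematicalPhysics.QuantumFieldTheory.Balaban1983to89.Node00
open Summit.QuantumFields.YangMills.BalabanUVNodes.N07DirectMethod (continuous_wilsonAction4 exists_isBackground_closure_bgReg)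
open Summit.QuantumFields.YangMills.BalabanUVNodes.N07DirectMethodInduction (ukExists_of_closureMinimisers_mem)
open Summit.QuantumFields.YangMills.BalabanUVNodes.N09SelectorContinuousOfUniqueOrbit
  (isCompact_closureFibre upperHemicontinuous_closureFibre isOpen_bgReg' isBackground_of_closureMinimiser isBackground_iff_minimiser)
open Summit.QuantumFields.YangMills.BalabanUVNodes.N09AveragingOpenAtSmallFields (hopen_of_plaqSmall)
open Summit.QuantumFields.YangMills.BalabanUVNodes.N09SelectorContinuousOfThm1TwoRadii (interior_of_thm1_of_reg8 openFibre_nonempty_of_reg8)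
open Summit.QuantumFields.YangMills.BalabanUVNodes.N09FlatSectorUniqueness
  (mem_bgReg_of_flat mem_bgReg_of_flat_of_mem isBackground_of_flat uniqueUkOrbit_of_flat_iter h11_of_flat_iter Uk_mem_bgReg_of_flat_iter holFlat_of_flat)
open Summit.QuantumFields.YangMills.Theorems.Prop7FlatDatum (plaqHol_eq_one_of_wilsonAction4_eq_zero)
open Summit.QuantumFields.YangMills.Theorems.Prop7FlatRigidity (wilsonAction4_eq_zero_of_holFlat)
open GaugeField (plaqHol)

variable {F : T4Family} {N : ℕ} [NeZero N]

/-! ## §1 The bare `U_k(V)` minimises over the closed class; the background action is continuous (no uniqueness) -/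

/-- ★ **UNDER (E) + (I) THE BARE CHOICE `U_k^{(e)}(V)` MINIMISES THE WILSON ACTION OVER THE CLOSED CLASS `closure (bgReg e) ∩ 𝔅_k(V)`** (`e < α₀` admissible as in (53)):
the direct method gives a closed-class minimiser (N07), interior by (I), so `U_k(V)` — a minimiser over the open class, solvable by N07's `ukExists_of_closureMinimisers_mem` —
has the same action. [cite: Balaban1985Variational, Thm 1 (8) p.279, Prop. 7 p.299; Balaban1987RG1, (0.21) p.256] -/
theorem isBackground_closure_Uk_of_interior (K k : ℕ) {e α₀ : ℝ} (he : e < α₀) (hα : 0 < α₀)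
    (hα3 : (143 * (((((F.P K).d + 4 : ℕ) : ℝ)) ^ 2 / 4) ^ 2) * α₀ ≤ 1 / 3)
    (hα2 : 2 * α₀ ≤ 2 * deltaSU (Fin N) / ((((F.P K).d + 4) * (F.P K).L : ℕ) : ℝ) ^ 2) {V : GaugeField (F.P K) k (SU N)}
    (hne : ∃ U ∈ bgReg F N K k e, Averaging.iter (avOfRecord F N K) k U = V)
    (hint : ∀ U₀ : GaugeField (F.P K) 0 (SU N), IsBackground (avOfRecord F N K) (closure (bgReg F N K k e)) k V U₀ → U₀ ∈ bgReg F N K k e) :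
    IsBackground (avOfRecord F N K) (closure (bgReg F N K k e)) k V (Uk F N K k e V) := by
  have hex : UkExists F N K k e V := ukExists_of_closureMinimisers_mem K k he hα hα3 hα2 hne hint
  have hbg := isBackground_Uk hex
  obtain ⟨U₀, h₀⟩ := exists_isBackground_closure_bgReg K k he hα hα3 hα2 hne
  refine ⟨hbg.1, subset_closure hbg.2.1, fun U hU hUV => ?_⟩
  exact (hbg.2.2 U₀ (hint U₀ h₀) h₀.1).trans (h₀.2.2 U hU hUV)

/-- ★★★ **THE BACKGROUND ACTION `V ↦ A^η(U_k^{(e)}(V))` IS CONTINUOUS, FOR THE BARE CHOICE, WITHOUT UNIQUENESS.**  On a set `D` of level-`k` data carrying (E) open-class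
solvability and (I) N07's interiority, with `e < α₀` (`α₀` admissible as in (53) plus the two loop-guard numerics on `2α₀`) and `k ≤ m + K`, the Wilson action of node00-def-B's
`Uk F N K k e V` is continuous at every `V₀ ∈ D` within `D`.  Berge's value theorem (`Literature.Topology.tendsto_optimalValue`) on the compact, upper hemicontinuous closed-class
fibres, lower hemicontinuity at the minimisers being the openness of `Ū^k` (`…N09AveragingOpenAtSmallFields.hopen_of_plaqSmall`).
[cite: Balaban1987RG1, (0.21)–(0.22) p.256; Balaban1985Variational, Thm 1 p.279] -/
theorem continuousWithinAt_wilsonAction4_Uk_of_interior (K k : ℕ) {e α₀ : ℝ} (he : e < α₀) (hα : 0 < α₀)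
    (hα3 : (143 * (((((F.P K).d + 4 : ℕ) : ℝ)) ^ 2 / 4) ^ 2) * α₀ ≤ 1 / 3)
    (hα2 : 2 * α₀ ≤ 2 * deltaSU (Fin N) / ((((F.P K).d + 4) * (F.P K).L : ℕ) : ℝ) ^ 2)
    (hα24 : ((((F.P K).d + 2) * (F.P K).L : ℕ) : ℝ) ^ 2 / 4 * (2 * α₀) ≤ 1 / 24)
    (hαL : 157 * (((((F.P K).d + 2) * (F.P K).L : ℕ) : ℝ) ^ 2 / 4 * (2 * α₀)) < (((F.P K).L : ℝ) ^ ((F.P K).d - 1))⁻¹)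
    (hk : k ≤ (F.P K).m + (F.P K).K) {D : Set (GaugeField (F.P K) k (SU N))} {V₀ : GaugeField (F.P K) k (SU N)} (hV₀ : V₀ ∈ D)
    (hne : ∀ V ∈ D, ∃ U ∈ bgReg F N K k e, Averaging.iter (avOfRecord F N K) k U = V)
    (hint : ∀ V ∈ D, ∀ U₀ : GaugeField (F.P K) 0 (SU N),
      IsBackground (avOfRecord F N K) (closure (bgReg F N K k e)) k V U₀ → U₀ ∈ bgReg F N K k e) :
    ContinuousWithinAt (fun V => wilsonAction4 (Uk F N K k e V)) D V₀ := by
  set Φ : GaugeField (F.P K) 0 (SU N) → GaugeField (F.P K) k (SU N) := Averaging.iter (avOfRecord F N K) k with hΦ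
  set Γ : GaugeField (F.P K) k (SU N) → Set (GaugeField (F.P K) 0 (SU N)) := fun V => closure (bgReg F N K k e) ∩ Φ ⁻¹' {V} with hΓ
  have hFc : ∀ U ∈ Γ V₀, ContinuousAt (fun p : GaugeField (F.P K) k (SU N) × GaugeField (F.P K) 0 (SU N) => wilsonAction4 p.2) (V₀, U) :=
    fun _ _ => (continuous_wilsonAction4.comp continuous_snd).continuousAt
  have hΓc : IsCompact (Γ V₀) := isCompact_closureFibre K k he hα hα3 hα2 V₀
  have hup : UpperHemicontinuousWithinAt Γ D V₀ :=
    fun t ht => ((upperHemicontinuous_closureFibre K k he hα hα3 hα2) V₀ t ht).filter_mono nhdsWithin_le_nhds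
  have hlow : ∀ U ∈ Γ V₀, IsMinOn (fun U => wilsonAction4 U) (Γ V₀) U →
      ∀ u : Set (GaugeField (F.P K) 0 (SU N)), IsOpen u → U ∈ u → ∀ᶠ V in 𝓝[D] V₀, (Γ V ∩ u).Nonempty := by
    intro U hU hmin u hu hUu
    have hbg : IsBackground (avOfRecord F N K) (bgReg F N K k e) k V₀ U := isBackground_of_closureMinimiser (hint V₀ hV₀) hU hmin
    have hO : u ∩ bgReg F N K k e ∈ 𝓝 U := (hu.inter (isOpen_bgReg' K k e)).mem_nhds ⟨hUu, hbg.2.1⟩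
    filter_upwards [hopen_of_plaqSmall K k he hα hα3 hα2 hα24 hαL hk D hbg _ hO] with V hV
    obtain ⟨U', ⟨hU'u, hU'bg⟩, hU'V⟩ := hV
    exact ⟨U', ⟨subset_closure hU'bg, hU'V⟩, hU'u⟩
  -- the bare choice is a closed-class minimiser at `V₀` and at every `V ∈ D`
  have hmin : ∀ V ∈ D, Uk F N K k e V ∈ Γ V ∧ IsMinOn (fun U => wilsonAction4 U) (Γ V) (Uk F N K k e V) :=
    fun V hV => isBackground_iff_minimiser.1 (isBackground_closure_Uk_of_interior K k he hα hα3 hα2 (hne V hV) (hint V hV))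
  have hσ : ∀ᶠ V in 𝓝[D] V₀, Uk F N K k e V ∈ Γ V ∧ IsMinOn (fun U => wilsonAction4 U) (Γ V) (Uk F N K k e V) := by
    filter_upwards [eventually_mem_nhdsWithin] with V hV
    exact hmin V hV
  exact tendsto_optimalValue (F := fun p : GaugeField (F.P K) k (SU N) × GaugeField (F.P K) 0 (SU N) => wilsonAction4 p.2) (Γ := Γ)
    hFc hΓc hup hlow (hmin V₀ hV₀).1 (hmin V₀ hV₀).2 hσ

/-- The same on the whole set: `ContinuousOn (fun V => wilsonAction4 (Uk F N K k e V)) D`. [cite: Balaban1987RG1, (0.21)–(0.22) p.256] -/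
theorem continuousOn_wilsonAction4_Uk_of_interior (K k : ℕ) {e α₀ : ℝ} (he : e < α₀) (hα : 0 < α₀)
    (hα3 : (143 * (((((F.P K).d + 4 : ℕ) : ℝ)) ^ 2 / 4) ^ 2) * α₀ ≤ 1 / 3)
    (hα2 : 2 * α₀ ≤ 2 * deltaSU (Fin N) / ((((F.P K).d + 4) * (F.P K).L : ℕ) : ℝ) ^ 2)
    (hα24 : ((((F.P K).d + 2) * (F.P K).L : ℕ) : ℝ) ^ 2 / 4 * (2 * α₀) ≤ 1 / 24)
    (hαL : 157 * (((((F.P K).d + 2) * (F.P K).L : ℕ) : ℝ) ^ 2 / 4 * (2 * α₀)) < (((F.P K).L : ℝ) ^ ((F.P K).d - 1))⁻¹)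
    (hk : k ≤ (F.P K).m + (F.P K).K) {D : Set (GaugeField (F.P K) k (SU N))}
    (hne : ∀ V ∈ D, ∃ U ∈ bgReg F N K k e, Averaging.iter (avOfRecord F N K) k U = V)
    (hint : ∀ V ∈ D, ∀ U₀ : GaugeField (F.P K) 0 (SU N),
      IsBackground (avOfRecord F N K) (closure (bgReg F N K k e)) k V U₀ → U₀ ∈ bgReg F N K k e) :
    ContinuousOn (fun V => wilsonAction4 (Uk F N K k e V)) D :=
  fun _ hV₀ => continuousWithinAt_wilsonAction4_Uk_of_interior K k he hα hα3 hα2 hα24 hαL hk hV₀ hne hint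

/-! ## §2 On the small-field domains, from the two-radii binders -/

/-- ★★★ **THE BACKGROUND ACTION AT THE CUT-OFF's RADIUS IS CONTINUOUS ON EVERY SMALL-FIELD DOMAIN**, from dag-n09-w1 g2's two-radii binders `h11` ([B11] Thm 1 ×2 at `εbg`) and
`hreg8` ((8)-membership), `ν.εreg < εbg`, and numerics (`ν.εreg < α₀`, (53), loop guard): `∀ k ≤ K, ContinuousOn (fun V => wilsonAction4 (Uk F N K k ν.εreg V)) (domAltOfRecord F N ν K k)`.
[cite: Balaban1987RG1, (0.21)–(0.22) p.256 and p.259; Balaban1985Variational, Thm 1 (6), (8) p.279] -/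
theorem continuousOn_wilsonAction4_Uk_domAlt_of_thm1_εbg_of_reg8 (ν : Stage7Numerics) (εbg : ℝ) (K : ℕ) {α₀ : ℝ} (hlt : ν.εreg < εbg) (he : ν.εreg < α₀)
    (hα : 0 < α₀) (hα3 : (143 * (((((F.P K).d + 4 : ℕ) : ℝ)) ^ 2 / 4) ^ 2) * α₀ ≤ 1 / 3)
    (hα2 : 2 * α₀ ≤ 2 * deltaSU (Fin N) / ((((F.P K).d + 4) * (F.P K).L : ℕ) : ℝ) ^ 2)
    (hα24 : ((((F.P K).d + 2) * (F.P K).L : ℕ) : ℝ) ^ 2 / 4 * (2 * α₀) ≤ 1 / 24)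
    (hαL : 157 * (((((F.P K).d + 2) * (F.P K).L : ℕ) : ℝ) ^ 2 / 4 * (2 * α₀)) < (((F.P K).L : ℝ) ^ ((F.P K).d - 1))⁻¹)
    (h11 : ∀ k, k ≤ K → ∀ V ∈ domAltOfRecord F N ν K k, UkExists F N K k εbg V ∧ UniqueUkOrbit F N K k εbg V)
    (hreg8 : ∀ k, k ≤ K → ∀ V ∈ domAltOfRecord F N ν K k, Uk F N K k εbg V ∈ bgReg F N K k ν.εreg) :
    ∀ k, k ≤ K → ContinuousOn (fun V => wilsonAction4 (Uk F N K k ν.εreg V)) (domAltOfRecord F N ν K k) := by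
  intro k hkK
  have hk : k ≤ (F.P K).m + (F.P K).K := by
    rw [T4Family.P_K]
    have := (F.P K).m
    omega
  exact continuousOn_wilsonAction4_Uk_of_interior K k he hα hα3 hα2 hα24 hαL hk
    (fun V hV => openFibre_nonempty_of_reg8 (h11 k hkK V hV).1 (hreg8 k hkK V hV))
    (fun V hV => interior_of_thm1_of_reg8 hlt (h11 k hkK V hV).1 (h11 k hkK V hV).2 (hreg8 k hkK V hV))

/-- ★★ **node00-def-B's `wilsonBGOfRecord ν.εreg p k = A^η(U_k(V))` IS CONTINUOUS ON THE SMALL-FIELD DOMAINS OF THE RUN `p`** (same inputs at `K = p.K`).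
[cite: Balaban1987RG1, (0.22) p.256] -/
theorem continuousOn_wilsonBGOfRecord_domAlt_of_thm1_εbg_of_reg8 (ν : Stage7Numerics) (εbg : ℝ) (p : B12.RunParams) {α₀ : ℝ} (hlt : ν.εreg < εbg)
    (he : ν.εreg < α₀) (hα : 0 < α₀) (hα3 : (143 * (((((F.P p.K).d + 4 : ℕ) : ℝ)) ^ 2 / 4) ^ 2) * α₀ ≤ 1 / 3)
    (hα2 : 2 * α₀ ≤ 2 * deltaSU (Fin N) / ((((F.P p.K).d + 4) * (F.P p.K).L : ℕ) : ℝ) ^ 2)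
    (hα24 : ((((F.P p.K).d + 2) * (F.P p.K).L : ℕ) : ℝ) ^ 2 / 4 * (2 * α₀) ≤ 1 / 24)
    (hαL : 157 * (((((F.P p.K).d + 2) * (F.P p.K).L : ℕ) : ℝ) ^ 2 / 4 * (2 * α₀)) < (((F.P p.K).L : ℝ) ^ ((F.P p.K).d - 1))⁻¹)
    (h11 : ∀ k, k ≤ p.K → ∀ V ∈ domAltOfRecord F N ν p.K k, UkExists F N p.K k εbg V ∧ UniqueUkOrbit F N p.K k εbg V)
    (hreg8 : ∀ k, k ≤ p.K → ∀ V ∈ domAltOfRecord F N ν p.K k, Uk F N p.K k εbg V ∈ bgReg F N p.K k ν.εreg) :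
    ∀ k, k ≤ p.K → ContinuousOn (wilsonBGOfRecord F N ν.εreg p k) (domAltOfRecord F N ν p.K k) :=
  continuousOn_wilsonAction4_Uk_domAlt_of_thm1_εbg_of_reg8 ν εbg p.K hlt he hα hα3 hα2 hα24 hαL h11 hreg8

/-! ## §3 A6: on the flat sector the displayed inputs of the whole line hold at every level -/

/-- **(E) ∧ (I) ∧ (U) AT A FLAT-SECTOR DATUM** `V = M^k(U_f)`, `U_f` plaquette-flat, every radius `e > 0`, every level `k ≤ m + K`: the open-class fibre contains `U_f`; a closed-class
minimiser has action `≤ A(U_f) = 0`, so it is flat, so it lies in `bgReg e`; the minimal orbit is unique (dag-n09-w1 g3's rigidity). [cite: Balaban1985Variational, Thm 1 p.279 and (4) p.278; Balaban1987RG1, (0.21) p.256] -/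
theorem flatSector_inputs {K k : ℕ} (hk : k ≤ (F.P K).m + (F.P K).K) {e : ℝ} (he : 0 < e) {Uf : GaugeField (F.P K) 0 (SU N)} (hU : ∀ q, plaqHol Uf q = 1) :
    (∃ U ∈ bgReg F N K k e, Averaging.iter (avOfRecord F N K) k U = Averaging.iter (avOfRecord F N K) k Uf) ∧
    (∀ U₀ : GaugeField (F.P K) 0 (SU N), IsBackground (avOfRecord F N K) (closure (bgReg F N K k e)) k (Averaging.iter (avOfRecord F N K) k Uf) U₀ →
      U₀ ∈ bgReg F N K k e) ∧
    UniqueUkOrbit F N K k e (Averaging.iter (avOfRecord F N K) k Uf) := by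
  refine ⟨⟨Uf, mem_bgReg_of_flat hU k he, rfl⟩, fun U₀ h₀ => ?_, uniqueUkOrbit_of_flat_iter hk e hU⟩
  have hA : wilsonAction4 U₀ ≤ 0 := by
    have h1 := h₀.2.2 Uf (subset_closure (mem_bgReg_of_flat hU k he)) rfl
    rwa [wilsonAction4_eq_zero_of_holFlat Uf (holFlat_of_flat hU)] at h1
  have hflat : ∀ q, plaqHol U₀ q = 1 := plaqHol_eq_one_of_wilsonAction4_eq_zero U₀ (le_antisymm hA (wilsonAction4_nonneg U₀))
  exact mem_bgReg_of_flat hflat k he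

/-- **THE TWO-RADII BINDERS AT A FLAT-SECTOR DATUM**: `h11` at any `εbg > 0` and `hreg8` at any `e > 0` (dag-n09-w1 g3, cited). [cite: Balaban1985Variational, Thm 1 (6), (8) p.279] -/
theorem flatSector_twoRadii_inputs {K k : ℕ} (hk : k ≤ (F.P K).m + (F.P K).K) {e εbg : ℝ} (he : 0 < e) (hεbg : 0 < εbg) {Uf : GaugeField (F.P K) 0 (SU N)}
    (hU : ∀ q, plaqHol Uf q = 1) :
    (UkExists F N K k εbg (Averaging.iter (avOfRecord F N K) k Uf) ∧ UniqueUkOrbit F N K k εbg (Averaging.iter (avOfRecord F N K) k Uf)) ∧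
    Uk F N K k εbg (Averaging.iter (avOfRecord F N K) k Uf) ∈ bgReg F N K k e :=
  ⟨h11_of_flat_iter hk hεbg hU, Uk_mem_bgReg_of_flat_iter k hεbg hU k he⟩

end Summit.QuantumFields.YangMills.BalabanUVNodes.N09BackgroundActionContinuous

end
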